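import Summits.Schanuel.Schanuel.Theorems.RootDecomp1KHyper22

/-!
# RootDecomp1KHyper — lens 6, generation 15 «QUAD-ANCHORED CELL» (QuadAnchor.lean 33b3769e…, 2400 l) — continuation (RootDecomp1KHyper23): `im_eq_zero_of_anchor`; §3b engine corollaries (`algebraicIndependent_option_of_mvWeakMeasure_hyperQuad`, `sb_of_hyperQuad_of_mvWeakMeasure`, `sb_of_hyperQuad_of_LW`; moved here by the port); §4 second half: EXTRACTION `hyperQuadApprox_of_anchor`, MAIN `sb_three_of_realQuadAnchor` (mod hLW), `rank3SpanResidual_iff_unanchored`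

(lens-6 g15 `QuadAnchor.lean`, sha256 33b3769e…6b415, farm rc 0 · 0 sorry · axioms standard; port by census-1 gen 14 in eight parts RootDecomp1KHyper20–27 at the section
cuts of CENSUS-REQUEST 2026-08-31T01:16:56Z (STATUS L1528; §5 cut at §5b; §3's three engine corollaries moved to where they are first used); each part imports the
previous; statements and proofs verbatim (54 one-line docstrings added, six generic one-liners privatised with per-part private copies, the two `linter.*` options dropped, two unused binders renamed `_`); `hLW : LWMeasure` (tree-proved
named fact) stays a binder where marked; `--supports stmt-Schanuel-33363` (A₄ʰ HyperLiouvilleSchanuel, residual of record `Rank3SpanResidual`). Nothing here proves Schanuel; rung 0.)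
-/

noncomputable section

open Complex IntermediateField Polynomial

namespace Summit.Schanuel.Schanuel.Theorems.RootDecomp1KHyper

namespace HyperCell
variable {n : ℕ}
open Summit.Schanuel.Schanuel.Theorems.RootDecomp1KGeneric (HasHLPairInSpan Rank3SpanResidual
  mem_adjoin_of_mem_span cexp_mem_adjoin_of_mem_span)

/-- `exp(−x) ≤ 1/x` for `x > 0`. -/
private theorem exp_neg_le_one_div' {x : ℝ} (hx : 0 < x) : Real.exp (-x) ≤ 1 / x := by
  rw [Real.exp_neg, ← one_div]
  exact one_div_le_one_div_of_le hx (by linarith [Real.add_one_le_exp x])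

set_option maxHeartbeats 1000000 in

/-- `(q : ℝ) · den q = num q`. -/
private theorem ratCast_mul_den (q : ℚ) : (q : ℝ) * q.den = q.num := by
  exact_mod_cast Rat.mul_den_eq_num q

/-- **The anchored coordinate is REAL**: `Im z_j = 0` (`|C| |Im z_j| = |c_j| |Im (h·z)| → 0`). -/
theorem im_eq_zero_of_anchor {z : Fin 3 → ℂ} (hz : LinearIndependent ℚ z) (hH : HyperLinLiouville z)
    {D : ℕ} (hD : Irrational (Real.sqrt D)) {q₁ q₂ : ℚ} (hq₁ : q₁ ≠ 0) (hq₂ : q₂ ≠ 0)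
    {a b : Fin 3 → ℤ} (ha : ∑ i, (a i : ℂ) * z i = (q₁ : ℂ))
    (hb : ∑ i, (b i : ℂ) * z i = (q₂ : ℂ) * ((Real.sqrt D : ℝ) : ℂ)) {j : Fin 3}
    (hj : cvec a b j ≠ 0) : (z j).im = 0 := by
  by_contra him
  have ht : 0 < |(z j).im| := abs_pos.mpr him
  obtain ⟨mL, hmL⟩ := exists_level_dot_ne_zero hz hD hq₁ hq₂ ha hb hj
  have hcj0 : 0 < |(cvec a b j : ℝ)| := by
    rw [← Int.cast_abs]; exact_mod_cast (abs_pos.mpr hj)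
  obtain ⟨c, hc⟩ := exists_half_pow_le (div_pos ht hcj0)
  obtain ⟨h, hh, hsmall⟩ := hH (mL + c)
  have hC := hmL (mL + c) (by omega) h hh hsmall
  set W : ℝ := 1 + ∑ i, |(h i : ℝ)| with hW
  have hW2 : 2 ≤ W := by rw [hW]; linarith only [one_le_hsum hh]
  set F : ℂ := ∑ i, (h i : ℂ) * z i with hF
  have hkey := cvec_key a b h z j
  rw [← hF, ha, hb] at hkey
  have him_eq : (cvec a b j : ℝ) * F.im = ((∑ i, cvec a b i * h i : ℤ) : ℝ) * (z j).im := by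
    have := congr_arg Complex.im hkey
    simp only [Complex.mul_im, Complex.add_im, Complex.intCast_re, Complex.intCast_im,
      Complex.ratCast_re, Complex.ratCast_im, Complex.ofReal_re, Complex.ofReal_im, Complex.mul_re,
      zero_mul, mul_zero, add_zero, sub_zero, zero_add] at this
    exact this
  have hCabs : 1 ≤ |((∑ i, cvec a b i * h i : ℤ) : ℝ)| := by
    rw [← Int.cast_abs]; exact_mod_cast Int.one_le_abs hC
  have h1 : |((∑ i, cvec a b i * h i : ℤ) : ℝ)| * |(z j).im| = |(cvec a b j : ℝ)| * |F.im| := by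
    rw [← abs_mul, ← him_eq, abs_mul]
  have h2 : |(cvec a b j : ℝ)| * |F.im| < |(cvec a b j : ℝ)| * Real.exp (-(W ^ (mL + c))) :=
    calc |(cvec a b j : ℝ)| * |F.im| ≤ |(cvec a b j : ℝ)| * ‖F‖ :=
          mul_le_mul_of_nonneg_left (Complex.abs_im_le_norm F) hcj0.le
      _ < |(cvec a b j : ℝ)| * Real.exp (-(W ^ (mL + c))) := mul_lt_mul_of_pos_left hsmall hcj0
  have h3 : Real.exp (-(W ^ (mL + c))) ≤ 1 / 2 ^ c := by
    have hWc : (2 : ℝ) ^ c ≤ W ^ (mL + c) :=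
      calc (2 : ℝ) ^ c ≤ W ^ c := pow_le_pow_left₀ (by norm_num) hW2 c
        _ ≤ W ^ (mL + c) := pow_le_pow_right₀ (by linarith only [hW2]) (by omega)
    calc Real.exp (-(W ^ (mL + c))) ≤ Real.exp (-(2 : ℝ) ^ c) :=
          Real.exp_le_exp.mpr (neg_le_neg hWc)
      _ ≤ 1 / 2 ^ c := exp_neg_le_one_div' (by positivity)
  have h4 : |(cvec a b j : ℝ)| * (1 / 2 ^ c) ≤ |(z j).im| := by
    have := mul_le_mul_of_nonneg_left hc hcj0.le
    rwa [mul_div_cancel₀ _ hcj0.ne'] at this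
  have h5 : |(z j).im| ≤ |((∑ i, cvec a b i * h i : ℤ) : ℝ)| * |(z j).im| :=
    le_mul_of_one_le_left ht.le hCabs
  have h6 : |(cvec a b j : ℝ)| * Real.exp (-(W ^ (mL + c))) ≤ |(cvec a b j : ℝ)| * (1 / 2 ^ c) :=
    mul_le_mul_of_nonneg_left h3 hcj0.le
  linarith only [h1, h2, h4, h5, h6]

/-! ### 3b. Corollaries of the engine (moved here by the port: used only from `sb_three_of_realQuadAnchor` on) -/

/-- **Weak class principle, hyper-quadratic version (kernel).** A tuple `θ` with an `MvWeakMeasure`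
and a real `y` hyper-approximable from `ℚ(√D)`, `√D ∉ ℚ`, form an algebraically independent
`(n+1)`-tuple `(y, θ₁, …, θₙ)`. -/
theorem algebraicIndependent_option_of_mvWeakMeasure_hyperQuad {n : ℕ} {θ : Fin n → ℂ}
    (hθ : MvWeakMeasure θ) {D : ℕ} (hD : Irrational (Real.sqrt D)) {y : ℝ}
    (hy : HyperQuadApprox D y) :
    AlgebraicIndependent ℚ (fun o : Option (Fin n) => o.elim (y : ℂ) θ) := by
  have hθi := algebraicIndependent_of_mvWeakMeasure hθ
  rw [hθi.option_iff_transcendental]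
  intro halg
  obtain ⟨K, G, hGK, hrel⟩ := exists_int_mvrelation halg
  exact no_int_relation_of_mvWeakMeasure_hyperQuad hθ hD hy G ⟨Fin.last K, hGK⟩ hrel

/-- **Cell, several-variables form (kernel).** A tuple `z : Fin (n+1) → ℂ` whose Schanuel field
`ℚ(z, e^z, i)` contains a hyper-quadratic real `y` and `n` numbers with a simultaneous weak measure
has Schanuel's bound `trdeg ≥ n + 1`. -/
theorem sb_of_hyperQuad_of_mvWeakMeasure {n : ℕ} {z : Fin (n + 1) → ℂ} {D : ℕ}
    (hD : Irrational (Real.sqrt D)) {y : ℝ} (hy : HyperQuadApprox D y)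
    (hyz : (y : ℂ) ∈ adjoin ℚ (SFset z ∪ {I}))
    {θ : Fin n → ℂ} (hθ : MvWeakMeasure θ) (hθz : ∀ j, θ j ∈ adjoin ℚ (SFset z ∪ {I})) :
    SB (n + 1) z := by
  have hai := algebraicIndependent_option_of_mvWeakMeasure_hyperQuad hθ hD hy
  refine sb_of_algebraicIndependent hai (by simp) fun o => ?_
  cases o with
  | none => exact hyz
  | some j => exact hθz j

/-- **Cell, Lindemann–Weierstrass-anchored form (mod `hLW`, discharged below by Ably 1994).**
ANY tuple `z : Fin (n+1) → ℂ` whose Schanuel field contains a hyper-quadratic real and the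
exponentials `e^{u₁}, …, e^{uₙ}` of ℚ-linearly independent algebraic numbers gets `trdeg ≥ n + 1`. -/
theorem sb_of_hyperQuad_of_LW (hLW : LWMeasure) {n : ℕ} {z : Fin (n + 1) → ℂ} {D : ℕ}
    (hD : Irrational (Real.sqrt D)) {y : ℝ} (hy : HyperQuadApprox D y)
    (hyz : (y : ℂ) ∈ adjoin ℚ (SFset z ∪ {I}))
    {u : Fin n → ℂ} (hu : ∀ i, IsAlgebraic ℚ (u i)) (hli : LinearIndependent ℚ u)
    (hmem : ∀ i, cexp (u i) ∈ adjoin ℚ (SFset z ∪ {I})) : SB (n + 1) z :=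
  sb_of_hyperQuad_of_mvWeakMeasure hD hy hyz
    (MvPolyMeasure.mvWeakMeasure (mvPolyMeasure_exp_of_LW hLW hu hli)) hmem

/-- **EXTRACTION**: the anchored (real) coordinate `y = z_j` of a ℚ-free `HyperLinLiouville` triple
with a real quadratic anchor is hyper-approximable from `ℚ(√D)` — the approximants are read off the
small forms: `Q y − (A' + B'√D) = ± d₁d₂ · c_j (h·z)`, height `≪ |h|₁`. -/
theorem hyperQuadApprox_of_anchor {z : Fin 3 → ℂ} (hz : LinearIndependent ℚ z)
    (hH : HyperLinLiouville z) {D : ℕ} (hD : Irrational (Real.sqrt D)) {q₁ q₂ : ℚ} (hq₁ : q₁ ≠ 0)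
    (hq₂ : q₂ ≠ 0) {a b : Fin 3 → ℤ} (ha : ∑ i, (a i : ℂ) * z i = (q₁ : ℂ))
    (hb : ∑ i, (b i : ℂ) * z i = (q₂ : ℂ) * ((Real.sqrt D : ℝ) : ℂ)) {j : Fin 3}
    (hj : cvec a b j ≠ 0) (hreal : (z j).im = 0) : HyperQuadApprox D (z j).re := by
  intro m
  -- constants
  set y : ℝ := (z j).re with hy
  have hzj : z j = (y : ℂ) := by
    apply Complex.ext <;> simp [hy, hreal]
  have hs0 : 0 ≤ Real.sqrt D := Real.sqrt_nonneg _
  set Sa : ℝ := ∑ i, |(a i : ℝ)| with hSa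
  set Sb : ℝ := ∑ i, |(b i : ℝ)| with hSb
  set Sc : ℝ := ∑ i, |(cvec a b i : ℝ)| with hSc
  have hSa0 : 0 ≤ Sa := Finset.sum_nonneg fun _ _ => abs_nonneg _
  have hSb0 : 0 ≤ Sb := Finset.sum_nonneg fun _ _ => abs_nonneg _
  have hSc0 : 0 ≤ Sc := Finset.sum_nonneg fun _ _ => abs_nonneg _
  have hd₁pos : (0 : ℝ) < q₁.den := by exact_mod_cast q₁.den_pos
  have hd₂pos : (0 : ℝ) < q₂.den := by exact_mod_cast q₂.den_pos
  have hq₁R : (q₁ : ℝ) * q₁.den = q₁.num := ratCast_mul_den q₁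
  have hq₂R : (q₂ : ℝ) * q₂.den = q₂.num := ratCast_mul_den q₂
  set cj : ℝ := |(cvec a b j : ℝ)| with hcj
  have hcj1 : 1 ≤ cj := by rw [hcj, ← Int.cast_abs]; exact_mod_cast Int.one_le_abs hj
  have hcj0 : 0 < cj := by linarith only [hcj1]
  set κ₂ : ℝ := 1 + (q₁.den : ℝ) * q₂.den * Sc + |(q₁.num : ℝ)| * q₂.den * Sb +
    |(q₂.num : ℝ)| * q₁.den * Sa with hκ₂
  have hκ₂1 : 1 ≤ κ₂ := by
    have : 0 ≤ (q₁.den : ℝ) * q₂.den * Sc + |(q₁.num : ℝ)| * q₂.den * Sb +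
        |(q₂.num : ℝ)| * q₁.den * Sa := by positivity
    rw [hκ₂]; linarith only [this]
  obtain ⟨mL, hmL⟩ := exists_level_dot_ne_zero hz hD hq₁ hq₂ ha hb hj
  obtain ⟨T₀, hT₀⟩ := exists_le_two_pow (κ₂ + cj)
  obtain ⟨T, hT⟩ : ∃ T : ℕ, T = T₀ + mL + 1 := ⟨_, rfl⟩
  -- the small form at level m T + T
  obtain ⟨h, hh, hsmall⟩ := hH (m * T + T)
  have hC := hmL (m * T + T) (le_trans (by omega) (Nat.le_add_left T (m * T))) h hh hsmall
  set C : ℤ := ∑ i, cvec a b i * h i with hCdef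
  set Sh : ℝ := ∑ i, |(h i : ℝ)| with hSh
  set W : ℝ := 1 + Sh with hW
  have hSh1 : 1 ≤ Sh := one_le_hsum hh
  have hW2 : 2 ≤ W := by rw [hW]; linarith only [hSh1]
  have hW1 : 1 ≤ W := by linarith only [hW2]
  have hW0 : 0 < W := by linarith only [hW2]
  have hShW : Sh ≤ W := by rw [hW]; linarith only [hSh1]
  set F : ℂ := ∑ i, (h i : ℂ) * z i with hF
  have hF0 : F ≠ 0 := form_ne_zero_of_linearIndependent hz hh
  have hkey := cvec_key a b h z j
  rw [← hF, ← hCdef, ha, hb, hzj] at hkey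
  set A : ℤ := cvec h b j with hA
  set B : ℤ := cvec a h j with hB
  -- the real number r = A q₁ + B q₂ √D + C y  and  cj ‖F‖ = |r|
  set r : ℝ := (A : ℝ) * q₁ + (B : ℝ) * (q₂ * Real.sqrt D) + (C : ℝ) * y with hr
  have hkeyR : (cvec a b j : ℂ) * F = (r : ℂ) := by rw [hkey, hr]; push_cast; ring
  have hnormF : cj * ‖F‖ = |r| := by
    rw [hcj]
    have := congr_arg (fun w : ℂ => ‖w‖) hkeyR
    simpa only [norm_mul, Complex.norm_intCast, Complex.norm_real, Real.norm_eq_abs] using this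
  have hCR : (C : ℝ) ≠ 0 := by exact_mod_cast hC
  have hCabs : 1 ≤ |(C : ℝ)| := by rw [← Int.cast_abs]; exact_mod_cast Int.one_le_abs hC
  have hr_ne : r ≠ 0 := by
    intro hr0
    have : (cvec a b j : ℂ) * F = 0 := by rw [hkeyR, hr0]; simp
    rcases mul_eq_zero.mp this with h1 | h1
    · exact hj (by exact_mod_cast h1)
    · exact hF0 h1
  -- the sign of C and the approximant (A' + B'√D)/Q, Q = |C| d₁ d₂
  set σ : ℤ := C.sign with hσ
  have hnatAbs : ((C.natAbs : ℕ) : ℝ) = |(C : ℝ)| := by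
    rw [Nat.cast_natAbs, Int.cast_abs]
  have hσC : (σ : ℝ) * (C.natAbs : ℝ) = C := by
    rw [hnatAbs]
    rcases lt_or_gt_of_ne hC with hlt | hgt
    · have hltR : (C : ℝ) < 0 := by exact_mod_cast hlt
      rw [hσ, Int.sign_eq_neg_one_of_neg hlt, abs_of_neg hltR]; push_cast; ring
    · have hgtR : (0 : ℝ) < C := by exact_mod_cast hgt
      rw [hσ, Int.sign_eq_one_of_pos hgt, abs_of_pos hgtR]; push_cast; ring
  have hσ1 : σ = 1 ∨ σ = -1 := by
    rcases lt_or_gt_of_ne hC with hlt | hgt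
    · exact Or.inr (Int.sign_eq_neg_one_of_neg hlt)
    · exact Or.inl (Int.sign_eq_one_of_pos hgt)
  have hσsq : (σ : ℝ) * σ = 1 := by
    rcases hσ1 with h1 | h1 <;> simp [h1]
  have hσabs : |(σ : ℝ)| = 1 := by
    rcases hσ1 with h1 | h1 <;> simp [h1]
  have hnat' : ((C.natAbs : ℕ) : ℝ) = σ * C := by
    calc ((C.natAbs : ℕ) : ℝ) = (σ : ℝ) * σ * (C.natAbs : ℝ) := by rw [hσsq, one_mul]
      _ = σ * ((σ : ℝ) * (C.natAbs : ℝ)) := by ring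
      _ = σ * C := by rw [hσC]
  set Q : ℕ := C.natAbs * q₁.den * q₂.den with hQ
  set A' : ℤ := -(σ * A * q₁.num * q₂.den) with hA'
  set B' : ℤ := -(σ * B * q₂.num * q₁.den) with hB'
  have hQpos : 0 < Q := by
    rw [hQ]; exact Nat.mul_pos (Nat.mul_pos (Int.natAbs_pos.mpr hC) q₁.den_pos) q₂.den_pos
  have hQR : (Q : ℝ) = |(C : ℝ)| * q₁.den * q₂.den := by rw [hQ]; push_cast; rw [hnatAbs]
  have hQposR : (0 : ℝ) < Q := by exact_mod_cast hQpos
  have hQ0 : (Q : ℝ) ≠ 0 := hQposR.ne'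
  have hQge : (q₁.den : ℝ) * q₂.den ≤ Q := by
    rw [hQR]
    calc (q₁.den : ℝ) * q₂.den = 1 * ((q₁.den : ℝ) * q₂.den) := by ring
      _ ≤ |(C : ℝ)| * ((q₁.den : ℝ) * q₂.den) := mul_le_mul_of_nonneg_right hCabs (by positivity)
      _ = |(C : ℝ)| * q₁.den * q₂.den := by ring
  have hQy : (Q : ℝ) * y - ((A' : ℝ) + B' * Real.sqrt D) = (σ : ℝ) * q₁.den * q₂.den * r := by
    rw [hQ, hA', hB', hr]
    push_cast
    rw [hnat']
    linear_combination (-(σ : ℝ) * (A : ℝ) * (q₂.den : ℝ)) * hq₁R +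
      (-(σ : ℝ) * (B : ℝ) * (q₁.den : ℝ) * Real.sqrt D) * hq₂R
  have hdiff : y - ((A' : ℝ) + B' * Real.sqrt D) / Q = (σ : ℝ) * q₁.den * q₂.den * r / Q := by
    rw [← hQy]; field_simp
  have hdist : |y - ((A' : ℝ) + B' * Real.sqrt D) / Q| < cj * Real.exp (-(W ^ (m * T + T))) := by
    rw [hdiff, abs_div, Nat.abs_cast, div_lt_iff₀ hQposR]
    simp only [abs_mul, hσabs, one_mul, Nat.abs_cast]
    calc (q₁.den : ℝ) * q₂.den * |r| = |r| * ((q₁.den : ℝ) * q₂.den) := by ring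
      _ ≤ |r| * Q := mul_le_mul_of_nonneg_left hQge (abs_nonneg r)
      _ = cj * ‖F‖ * Q := by rw [hnormF]
      _ < cj * Real.exp (-(W ^ (m * T + T))) * Q := by
          apply mul_lt_mul_of_pos_right _ hQposR
          exact mul_lt_mul_of_pos_left hsmall hcj0
  have hyne : y ≠ ((A' : ℝ) + B' * Real.sqrt D) / Q := by
    intro h0
    have h1 : (σ : ℝ) * q₁.den * q₂.den * r / Q = 0 := by rw [← hdiff, ← h0, sub_self]
    rw [div_eq_zero_iff] at h1
    rcases h1 with h1 | h1
    · have hσ0 : (σ : ℝ) ≠ 0 := by rw [← abs_ne_zero, hσabs]; exact one_ne_zero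
      have : r = 0 := by
        rcases mul_eq_zero.mp h1 with h2 | h2
        · rcases mul_eq_zero.mp h2 with h3 | h3
          · rcases mul_eq_zero.mp h3 with h4 | h4
            · exact absurd h4 hσ0
            · exact absurd h4 hd₁pos.ne'
          · exact absurd h3 hd₂pos.ne'
        · exact h2
      exact hr_ne this
    · exact hQ0 h1
  -- height of the approximant: 1 + Q + |A'| + |B'| ≤ κ₂ W
  have hAle : |(A : ℝ)| ≤ Sh * Sb := abs_cvec_le h b j
  have hBle : |(B : ℝ)| ≤ Sa * Sh := abs_cvec_le a h j
  have hCle : |(C : ℝ)| ≤ Sc * Sh := by rw [hCdef]; exact abs_dot_le (cvec a b) h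
  have hsize : 1 + (Q : ℝ) + |(A' : ℝ)| + |(B' : ℝ)| ≤ κ₂ * W := by
    rw [hQR, hA', hB']
    push_cast
    simp only [abs_neg, abs_mul, hσabs, one_mul, Nat.abs_cast]
    have h1 : |(C : ℝ)| * q₁.den * q₂.den ≤ W * ((q₁.den : ℝ) * q₂.den * Sc) := by
      calc |(C : ℝ)| * q₁.den * q₂.den ≤ Sc * Sh * q₁.den * q₂.den := by gcongr
        _ ≤ Sc * W * q₁.den * q₂.den := by gcongr
        _ = W * ((q₁.den : ℝ) * q₂.den * Sc) := by ring
    have h2 : |(A : ℝ)| * |(q₁.num : ℝ)| * q₂.den ≤ W * (|(q₁.num : ℝ)| * q₂.den * Sb) := by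
      calc |(A : ℝ)| * |(q₁.num : ℝ)| * q₂.den ≤ Sh * Sb * |(q₁.num : ℝ)| * q₂.den := by gcongr
        _ ≤ W * Sb * |(q₁.num : ℝ)| * q₂.den := by gcongr
        _ = W * (|(q₁.num : ℝ)| * q₂.den * Sb) := by ring
    have h3 : |(B : ℝ)| * |(q₂.num : ℝ)| * q₁.den ≤ W * (|(q₂.num : ℝ)| * q₁.den * Sa) := by
      calc |(B : ℝ)| * |(q₂.num : ℝ)| * q₁.den ≤ Sa * Sh * |(q₂.num : ℝ)| * q₁.den := by gcongr
        _ ≤ Sa * W * |(q₂.num : ℝ)| * q₁.den := by gcongr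
        _ = W * (|(q₂.num : ℝ)| * q₁.den * Sa) := by ring
    have h4 : 1 + |(C : ℝ)| * q₁.den * q₂.den + |(A : ℝ)| * |(q₁.num : ℝ)| * q₂.den +
        |(B : ℝ)| * |(q₂.num : ℝ)| * q₁.den ≤ W + W * ((q₁.den : ℝ) * q₂.den * Sc) +
          W * (|(q₁.num : ℝ)| * q₂.den * Sb) + W * (|(q₂.num : ℝ)| * q₁.den * Sa) := by
      linarith only [h1, h2, h3, hW1]
    calc _ ≤ _ := h4
      _ = κ₂ * W := by rw [hκ₂]; ring
  -- level bookkeeping: cj · exp(−W^(mT+T)) ≤ exp(−(κ₂ W)^m)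
  have hT₀1 : (1 : ℝ) ≤ 2 ^ T₀ := one_le_pow₀ (by norm_num)
  have h2T : κ₂ ≤ (2 : ℝ) ^ (T₀ + mL) := by
    calc κ₂ ≤ 2 ^ T₀ := by linarith only [hT₀, hcj0]
      _ ≤ 2 ^ (T₀ + mL) := pow_le_pow_right₀ (by norm_num) (by omega)
  have hWT : κ₂ * W ≤ W ^ T := by
    rw [hT, pow_succ]
    apply mul_le_mul_of_nonneg_right _ hW0.le
    exact h2T.trans (pow_le_pow_left₀ (by norm_num) hW2 _)
  have hWT' : cj + 1 ≤ W ^ T := by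
    calc cj + 1 ≤ 2 ^ T₀ + 2 ^ T₀ := by linarith only [hT₀, hT₀1, hκ₂1]
      _ = 2 ^ (T₀ + 1) := by rw [pow_succ]; ring
      _ ≤ 2 ^ T := pow_le_pow_right₀ (by norm_num) (by omega)
      _ ≤ W ^ T := pow_le_pow_left₀ (by norm_num) hW2 _
  have hκW1 : 1 ≤ κ₂ * W := one_le_mul_of_one_le_of_one_le hκ₂1 hW1
  have hκW0 : 0 ≤ κ₂ * W := by linarith only [hκW1]
  have hWT0 : 0 ≤ W ^ T := pow_nonneg hW0.le T
  have hmain : (κ₂ * W) ^ m + cj ≤ W ^ (m * T + T) := by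
    have e : W ^ (m * T + T) = (W ^ T) ^ m * W ^ T := by
      rw [pow_add, mul_comm m T, pow_mul]
    rw [e]
    have h1 : (κ₂ * W) ^ m ≤ (W ^ T) ^ m := pow_le_pow_left₀ hκW0 hWT m
    have h2 : 1 ≤ (κ₂ * W) ^ m := one_le_pow₀ hκW1
    have h3 : (κ₂ * W) ^ m * (cj + 1) ≤ (W ^ T) ^ m * W ^ T :=
      mul_le_mul h1 hWT' (by linarith only [hcj0]) (pow_nonneg hWT0 m)
    have h4 : cj ≤ (κ₂ * W) ^ m * cj := le_mul_of_one_le_left hcj0.le h2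
    calc (κ₂ * W) ^ m + cj ≤ (κ₂ * W) ^ m + (κ₂ * W) ^ m * cj := by linarith only [h4]
      _ = (κ₂ * W) ^ m * (cj + 1) := by ring
      _ ≤ (W ^ T) ^ m * W ^ T := h3
  have hfinal : cj * Real.exp (-(W ^ (m * T + T))) ≤
      Real.exp (-((1 + (Q : ℝ) + |(A' : ℝ)| + |(B' : ℝ)|) ^ m)) := by
    have hlog : Real.log cj ≤ cj - 1 := Real.log_le_sub_one_of_pos hcj0
    have h1 : cj * Real.exp (-(W ^ (m * T + T))) = Real.exp (Real.log cj + -(W ^ (m * T + T))) := by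
      rw [Real.exp_add, Real.exp_log hcj0]
    rw [h1]
    apply Real.exp_le_exp.mpr
    have h0 : 0 ≤ 1 + (Q : ℝ) + |(A' : ℝ)| + |(B' : ℝ)| := by
      linarith only [hQposR, abs_nonneg (A' : ℝ), abs_nonneg (B' : ℝ)]
    have h2 : (1 + (Q : ℝ) + |(A' : ℝ)| + |(B' : ℝ)|) ^ m ≤ (κ₂ * W) ^ m :=
      pow_le_pow_left₀ h0 hsize m
    linarith only [hlog, h2, hmain]
  exact ⟨A', B', Q, hQpos, hyne, hdist.trans_le hfinal⟩

/-- `√D` (as a complex number) is algebraic over ℚ. -/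
private theorem isAlgebraic_sqrt_natCast (D : ℕ) : IsAlgebraic ℚ ((Real.sqrt D : ℝ) : ℂ) := by
  have hs2 : ((Real.sqrt D : ℝ) : ℂ) ^ 2 = (D : ℂ) := by
    exact_mod_cast Real.sq_sqrt (Nat.cast_nonneg D)
  refine ⟨Polynomial.X ^ 2 - Polynomial.C (D : ℚ), ?_, ?_⟩
  · intro h0
    have := congr_arg (fun p : ℚ[X] => p.coeff 2) h0
    simp at this
  · simp [hs2]

/-- **MAIN THEOREM (the real-quadratic-anchored cell, mod the LW measure).**  A ℚ-free
`HyperLinLiouville` triple whose ℤ-span contains a non-zero rational and a non-zero rational multiple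
of a real quadratic irrationality has Schanuel's bound `trdeg ℚ(z, e^z) ≥ 3`. -/
theorem sb_three_of_realQuadAnchor (hLW : LWMeasure) {z : Fin 3 → ℂ} (hz : LinearIndependent ℚ z)
    (hH : HyperLinLiouville z) (hA : HasRealQuadAnchor z) : SB 3 z := by
  obtain ⟨D, q₁, q₂, hD, hq₁, hq₂, hm₁, hm₂⟩ := hA
  obtain ⟨a, ha⟩ := (Submodule.mem_span_range_iff_exists_fun ℤ).mp hm₁
  obtain ⟨b, hb⟩ := (Submodule.mem_span_range_iff_exists_fun ℤ).mp hm₂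
  simp only [zsmul_eq_mul] at ha hb
  obtain ⟨j, hj⟩ := exists_cvec_ne_zero hD hq₁ hq₂ ha hb
  have him := im_eq_zero_of_anchor hz hH hD hq₁ hq₂ ha hb hj
  have hy := hyperQuadApprox_of_anchor hz hH hD hq₁ hq₂ ha hb hj him
  have hzj : z j = (((z j).re : ℝ) : ℂ) := by
    apply Complex.ext <;> simp [him]
  -- the exponentials e^{q₁}, e^{q₂√D}
  set ρ : ℝ := ((q₂ / q₁ : ℚ) : ℝ) * Real.sqrt D with hρ
  have hρirr : Irrational ρ := hD.ratCast_mul (div_ne_zero hq₂ hq₁)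
  have hq₁C : (q₁ : ℂ) ≠ 0 := by exact_mod_cast hq₁
  have hu_eq : (![(q₁ : ℂ), (q₂ : ℂ) * ((Real.sqrt D : ℝ) : ℂ)] : Fin 2 → ℂ) =
      ![(q₁ : ℂ), (ρ : ℂ) * (q₁ : ℂ)] := by
    have e : (ρ : ℂ) * (q₁ : ℂ) = (q₂ : ℂ) * ((Real.sqrt D : ℝ) : ℂ) := by
      rw [hρ]; push_cast; field_simp
    rw [e]
  have hli : LinearIndependent ℚ (![(q₁ : ℂ), (q₂ : ℂ) * ((Real.sqrt D : ℝ) : ℂ)] : Fin 2 → ℂ) := by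
    rw [hu_eq]; exact linearIndependent_pair_of_irrational hq₁C hρirr
  refine sb_of_hyperQuad_of_LW hLW (n := 2) hD hy ?_
    (u := ![(q₁ : ℂ), (q₂ : ℂ) * ((Real.sqrt D : ℝ) : ℂ)]) ?_ hli ?_
  · rw [← hzj]; exact mem_adjoin_SFset_I' (Or.inl ⟨j, rfl⟩)
  · intro i
    match i with
    | 0 => simpa using isAlgebraic_algebraMap (R := ℚ) (A := ℂ) q₁
    | 1 => simpa using (isAlgebraic_algebraMap (R := ℚ) (A := ℂ) q₂).mul (isAlgebraic_sqrt_natCast D)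
  · intro i
    match i with
    | 0 => exact cexp_mem_adjoin_of_mem_span hm₁
    | 1 => exact cexp_mem_adjoin_of_mem_span hm₂

/-- **The residual SPLIT (pure logic, gauge-invariant on both sides).**  The span residual is
EQUIVALENT, mod the LW measure, to its un-anchored part: the anchored part is decided. -/
theorem rank3SpanResidual_iff_unanchored (hLW : LWMeasure) :
    Rank3SpanResidual ↔
      ∀ z : Fin 3 → ℂ, LinearIndependent ℚ z → HyperLinLiouville z →
        ¬ HasHLPairInSpan z → ¬ HasRealQuadAnchor z → SB 3 z :=
  ⟨fun hR z hz hH hp _ => hR z hz hH hp, fun hR z hz hH hp => by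
    by_cases hA : HasRealQuadAnchor z
    · exact sb_three_of_realQuadAnchor hLW hz hH hA
    · exact hR z hz hH hp hA⟩

end HyperCell

end Summit.Schanuel.Schanuel.Theorems.RootDecomp1KHyper
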